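import Summits.ABC.IUTFork.Repair.RHReachLedgerVolume
import Summits.ABC.IUTFork.Cor312LicenceShallowMultiSlot
import Summits.ABC.IUTFork.Cor312RegimeVerbatimPrVolSingle
import HarnessLib

/-!
# R-H ROUND 2 row 27 «reach-ledger» — (β) THE LABEL/PLACE BOOKKEEPING as a kernel theorem at `settingPrVolSharp`:
# reached LEVELS per label ∧ a nonnegative LEVEL BUDGET (per place: row 27's `HStarReachLedger`) ⟹ the typed [IUTchIII] Cor. 3.12 `Statement`

PROOF-ONLY file (0 definitions, 0 `Prop` facts; abc-iut cell, D-0079 RESCUE sub-cell R-H, rung LADDER-ABC:A2.RESCUE.H; pair n = 10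
typer abc-iut-rh-typ-10, row-27 support base per `plan/rescue/R-H/ROUND2/START-HERE.md` §2 «rh2-L1 takes (α) realisation … and (β)
the bookkeeping into `ObstructionSS28Window.statement_iff_avg_cellSlack`»; rh2-L1 silent since 20:04Z, so the support base files (β)).
TAKES NO SIDE on [IUTchIII] Cor. 3.12 or on any author (Mochizuki / Scholze–Stix / Joshi / Dupuy–Hilado); typed ≠ proved; instantiated ≠
endorsed; nothing here asserts abc proved or refuted. Row 27's `HStarReachLedger` (abc-iut-lens-nearmiss-1, p464022) is an R-H CANDIDATE =
a HYPOTHESIS SHAPE, never asserted; (α) below is a HYPOTHESIS BINDER, not proved here.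

THE DECOMPOSITION OF RECORD of row 27's k2 crux `RH.ReachLedgerQ2.K2Target27` (p468994): (α) REALISATION of the ledger's integers
`RH.ReachLedger.cellReachSlack` by (Ind2)-movers (reached q-ideles), (L1) abc-iut-rh-typ-10's `RH.ReachLedgerVolume.levels_le_cellSlack`
(p467585: a reached idele `t_q'` with `‖t_q'(x)‖ = ‖t_q(x)‖·p^{s_x/e_x}` forces `log p·Σ_{v⃗} Pr(v⃗)·⌊s/e⌋(v_{i+1}) ≤ σ_{i+1,p}`), (β) the
BOOKKEEPING from the per-place ledger to the procession-averaged cell slack. THIS FILE IS (β), with (α) carried as a binder: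
* §1 `statement_of_minorant_total_nonneg[_on]` — ANY situation/setting with `ThetaFinite`: a cellwise minorant `L ≤ σ`, finitely supported,
  with `0 ≤ Σ_i Σᶠ_{v_ℚ} L` gives the `Statement` (the `Situation`-level form of abc-iut-rh-typ-10's (β)-door
  `RH.ReachLedgerBudget.statement_of_cellSlack_minorant`, p469965, which is stated over a `LatticeSituation`).
* §2 `sum_weightPr_mul_last_eq_finsum` — the LAST-SLOT MARGINAL `Σ_{v⃗} Pr(v⃗)·f(v⃗(j)) = Σ_x Pr(x)·f(x)` (abc-iut-c312-7's indicator form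
  `Thm311.Real.sum_weightPr_mul_ite_last_eq` summed over `x`; Dupuy–Hilado `𝔼(f(v_j) : v⃗) = 𝔼(f)`).
* §3 `statement_settingPrVolSharp_of_levelBudget` — AT `settingPrVolSharp`: bad primes `W`, units of account `e_x ≥ 1`, level gains
  `s_i(x) ∈ ℤ`, per label a reached q-idele family `t_q'^{(i)}` with `‖t_q'^{(i)}(x)‖ = ‖t_q(x)‖·p^{s_i(x)/e_x}` over `W`; (α) multi-reach of
  `t_q'^{(i)}` at every packet over `W` (abc-iut-w5-d107's binder VERBATIM); nonnegative slack at the finite packets off `W`; and the CROSS-PLACE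
  LEVEL BUDGET `0 ≤ Σ_{p∈W} log p·Σ_{x∣p} Pr(x)·Σ_i ⌊s_i(x)/e_x⌋` ⟹ `Statement`. Archimedean packets are free
  (`cellSlack_nonneg_settingPrVolSharp_inl`: the q-region lies in the Θ-hull there, abc-iut-w5-d107 `qRegion_subset_thetaHull_settingDHVolSharp_inl`);
  `statement_settingPrVolSharp_of_placeLedger` — the PER-PLACE form `∀ x, 0 ≤ Σ_i ⌊s_i(x)/e_x⌋` (row 27: no cross-place financing);
  `cellSlack_nonneg_settingPrVolSharp_of_good` — primes with no bad place are free (identity movers, abc-iut-rp-d3's good-place branch).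
* companion `Repair/RHReachLedgerBookkeepingRow27.lean`, `statement_settingPrVolSharp_of_hStarReachLedger` — ROW 27 THROUGH DOOR (b): `HStarReachLedger l⋆ Fib (placeOf ∈ S) e m_q` ∧ (α:
  per label a q-idele family realising `cellReachSlack_{i+1}(x)` in `p`-exponent `·/e_x` at the bad places, units off `S`, multi-reached) ∧
  `‖t_Θ‖ = 1` off `S` ⟹ `Statement` (`ledgerSum_eq_sum` turns the list-fold ledger into the `Fin l⋆` sum). HENCE `K2Target27` REDUCES BY NAME
  TO (α) at the genuine bed (plus its dictionary binders, cf. abc-iut-rh2-q2-hull `RH2SigmaHull` for the row-15 analogue).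
HONEST SCOPE. OUR typed objects throughout (Dupuy–Hilado's (Ind2) = all `ℤ_p`-lattice automorphisms of the log-shell, STRONGER-THAN-PRINT;
abc-iut-c312-7's SHARP pilot boxes; volume reading of Step (xi)); (α) — whether movers ATTAIN the ledger's integers, in particular at MIXED
tuples whose donor slots sit at places of different local type — is row 27's open crux and is NOT claimed; no table cell is decided here.
[cite: DupuyHilado2025, §3.6, §3.9, §4.9] [cite: Mochizuki2012, IUTchIII Cor. 3.12 p. 173–174; Prop. 3.9 (i)–(iii) p. 116–117; Rmk. 3.9.3 pp. 119–120]
[claim: Mochizuki2012, status: disputed] for every IUT sentence quoted. Axioms: standard.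
-/

noncomputable section

open Set Function
open scoped Pointwise

namespace Summit.ABC.IUTFork.Repair.RH.ReachLedgerBookkeeping

open Cor312 Cor312Vol Literature.IUT.LogThetaLattice Literature.IUT.LogVolume NumberField IsDedekindDomain
  Summit.ABC.IUTFork.Thm311 Summit.ABC.IUTFork.Thm311.Real Summit.ABC.IUTFork.Repair.RH.ReachLedgerVolume

/-! ## §1. Generic door (any situation, any setting): a cell-slack MINORANT with nonnegative TOTAL gives the Statement -/

section Generic

variable {T : ThetaIndex} {S : Situation T} {P : Cor312.Setting S}

/-- **MINORANT WITH NONNEGATIVE TOTAL ⟹ STATEMENT** (any situation; `ThetaFinite` only). If `L(i, v_ℚ) ≤ σ_{i+1,v_ℚ} :=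
logvol(ⁿ˒°𝒰_{i+1,v_ℚ}) − qLocal_{i+1,v_ℚ}` at every cell, each `L(i, ·)` is finitely supported, and `0 ≤ Σ_i Σᶠ_{v_ℚ} L(i, v_ℚ)`, then the
typed [IUTchIII] Cor. 3.12 `Statement` holds: `−|log(q)| = PN(Σᶠ qLocal) ≤ PN(Σᶠ logvol ⁿ˒°𝒰) = −|log(Θ)|` (Prop. 3.9 (i), (iii) monotone).
The `LatticeSituation` form is abc-iut-rh-typ-10's `RH.ReachLedgerBudget.statement_of_cellSlack_minorant`. [claim: Mochizuki2012, status: disputed] -/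
theorem statement_of_minorant_total_nonneg (hfin : P.ThetaFinite) (L : Fin T.lstar → T.VQ → ℝ)
    (hsupp : ∀ i : Fin T.lstar, (Function.support (L i)).Finite)
    (hL : ∀ (i : Fin T.lstar) (vQ : T.VQ),
      L i vQ ≤ (S.D P.n).logvol _ vQ (P.thetaHull (Setting.labelSucc i) vQ) - P.qLocal (Setting.labelSucc i) vQ)
    (hsum : 0 ≤ ∑ i : Fin T.lstar, ∑ᶠ vQ : T.VQ, L i vQ) : P.Statement := by
  have key : ∀ i : Fin T.lstar, (∑ᶠ vQ : T.VQ, P.qLocal (Setting.labelSucc i) vQ) + ∑ᶠ vQ : T.VQ, L i vQ ≤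
      ∑ᶠ vQ : T.VQ, (P.thetaLocal (Setting.labelSucc i) vQ).untopD 0 := by
    intro i
    rw [← finsum_add_distrib (Cor312Vol.qLocal_support_finite (P := P) _) (hsupp i)]
    refine finsum_le_finsum' (((Cor312Vol.qLocal_support_finite (P := P) _).union (hsupp i)).subset
      (Function.support_add _ _))
      (hfin.2 i) fun vQ => ?_
    rw [thetaLocal_untopD_of_thetaFinite hfin]
    have h := hL i vQ
    show P.qLocal (Setting.labelSucc i) vQ + L i vQ ≤ _
    linarith
  constructor
  · unfold Setting.negLogTheta
    rw [if_pos hfin]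
    exact WithTop.coe_ne_top
  · unfold Setting.negLogTheta
    rw [if_pos hfin, WithTop.coe_le_coe]
    unfold Setting.negLogQ processionNormalized
    have hl : (0 : ℝ) ≤ (T.lstar : ℝ) := Nat.cast_nonneg _
    refine div_le_div_of_nonneg_right ?_ hl
    calc ∑ i : Fin T.lstar, ∑ᶠ vQ : T.VQ, P.qLocal (Setting.labelSucc i) vQ
        ≤ ∑ i : Fin T.lstar, ((∑ᶠ vQ : T.VQ, P.qLocal (Setting.labelSucc i) vQ) + ∑ᶠ vQ : T.VQ, L i vQ) := by
          rw [Finset.sum_add_distrib]; linarith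
      _ ≤ ∑ i : Fin T.lstar, ∑ᶠ vQ : T.VQ, (P.thetaLocal (Setting.labelSucc i) vQ).untopD 0 :=
          Finset.sum_le_sum fun i _ => key i

/-- **… with the minorant given on finite sets of rational places** `W i` per label (`L := 0` off `W i`, where `0 ≤ σ` is then required)
and the total a finite double sum. [claim: Mochizuki2012, status: disputed] -/
theorem statement_of_minorant_total_nonneg_on (hfin : P.ThetaFinite) (W : Fin T.lstar → Finset T.VQ)
    (L : Fin T.lstar → T.VQ → ℝ)
    (hL : ∀ (i : Fin T.lstar) (vQ : T.VQ), vQ ∈ W i →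
      L i vQ ≤ (S.D P.n).logvol _ vQ (P.thetaHull (Setting.labelSucc i) vQ) - P.qLocal (Setting.labelSucc i) vQ)
    (hoff : ∀ (i : Fin T.lstar) (vQ : T.VQ), vQ ∉ W i →
      0 ≤ (S.D P.n).logvol _ vQ (P.thetaHull (Setting.labelSucc i) vQ) - P.qLocal (Setting.labelSucc i) vQ)
    (hsum : 0 ≤ ∑ i : Fin T.lstar, ∑ vQ ∈ W i, L i vQ) : P.Statement := by
  classical
  refine statement_of_minorant_total_nonneg hfin (fun i vQ => if vQ ∈ W i then L i vQ else 0) (fun i => ?_)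
    (fun i vQ => ?_) ?_
  · exact (W i).finite_toSet.subset fun vQ hvQ => by
      by_contra h
      exact hvQ (if_neg h)
  · by_cases h : vQ ∈ W i
    · rw [if_pos h]; exact hL i vQ h
    · rw [if_neg h]; exact hoff i vQ h
  · refine hsum.trans_eq (Finset.sum_congr rfl fun i _ => ?_)
    rw [finsum_eq_sum_of_support_subset _ (s := W i)]
    · exact Finset.sum_congr rfl fun vQ hvQ => (if_pos hvQ).symm
    · intro vQ hvQ
      by_contra h
      exact hvQ (if_neg h)

end Generic

/-! ## §2. The last-slot marginal: `Σ_{v⃗} Pr(v⃗)·f(v_{j}) = Σ_x Pr(x)·f(x)` on the `(j+1)`-packet over `p` -/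

section Marginal

variable {F : Type} [Field F] [NumberField F] (X : PilotData F) {logv : PadicLogs F} (hlog : LogvAnalytic logv)

/-- **LAST-SLOT MARGINAL for an arbitrary profile**: `Σ_{v⃗} Pr(v⃗)·f(v⃗(j)) = Σᶠ_x Pr(x)·f(x)` over the places `x ∣ p`
(abc-iut-c312-7's indicator form `Thm311.Real.sum_weightPr_mul_ite_last_eq`, summed over `x`; Dupuy–Hilado `𝔼(f(v_j) : v⃗) = 𝔼(f)`).
[cite: DupuyHilado2025, §3.6; Thm. 3.10.1 proof] -/
theorem sum_weightPr_mul_last_eq_finsum (pp : Nat.Primes) (j : (thetaIndex X).Label)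
    (f : (thetaIndex X).Fibre (.inr pp) → ℝ) :
    haveI : Fact (pp : ℕ).Prime := ⟨pp.2⟩
    ∑ e : (presAt X hlog pp).toLocalPieces.E j, weightPr X pp.1 j e * f (e (Fin.last _)) =
      ∑ᶠ x : (thetaIndex X).Fibre (.inr pp), weight F (placeOf X pp.1 x) * f x := by
  haveI : Fact (pp : ℕ).Prime := ⟨pp.2⟩
  classical
  haveI : Fintype ((thetaIndex X).Fibre (.inr pp)) := Fintype.ofFinite _
  rw [finsum_eq_sum_of_fintype]
  have hf : ∀ e : (presAt X hlog pp).toLocalPieces.E j,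
      weightPr X pp.1 j e * f (e (Fin.last _)) =
        ∑ x : (thetaIndex X).Fibre (.inr pp), weightPr X pp.1 j e * (if e (Fin.last _) = x then f x else 0) := by
    intro e
    rw [← Finset.mul_sum, Finset.sum_ite_eq]
    simp only [Finset.mem_univ, if_true]
  simp only [hf]
  rw [Finset.sum_comm]
  exact Finset.sum_congr rfl fun x _ => sum_weightPr_mul_ite_last_eq X hlog pp j x (f x)

end Marginal

/-! ## §3. (β) THE BOOKKEEPING at `settingPrVolSharp`: reached levels per label ∧ nonnegative level budget ⟹ Statement -/

section Sharp

variable {F : Type} [Field F] [NumberField F] (X : PilotData F) {logv : PadicLogs F} (hlog : LogvAnalytic logv)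
  (M : Type) [Field M] [NumberField M]
  (archPk : ∀ (j : (thetaIndex X).Label) (vQ : (thetaIndex X).VQ), Set ((logShellsDH X logv).Packet j vQ))
  (archSub : ∀ (j : (thetaIndex X).Label) (v : (thetaIndex X).V),
    Set ((logShellsDH X logv).Packet j ((thetaIndex X).over v)))
  (Ψ : ℤ → ∀ v : (thetaIndex X).V, v ∈ (thetaIndex X).Vbad → Set ((logShellsDH X logv).StarPacket v))
  (act : ℤ → ∀ v : (thetaIndex X).V, v ∈ (thetaIndex X).Vbad →
    (logShellsDH X logv).StarPacket v → Module.End ℚ ((logShellsDH X logv).StarPacket v))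
  (Mmod : ℤ → ∀ j : (thetaIndex X).LabelStar, Set ((logShellsDH X logv).GlobalPacket j.1))
  (region : ℤ → ∀ j : (thetaIndex X).LabelStar, FinDivisor M → ∀ vQ : (thetaIndex X).VQ,
    Set ((logShellsDH X logv).Packet j.1 vQ))
  (n : ℤ) {HT : Type} {LogLink : HT → HT → Type} {IsFull : ∀ {s t : HT}, LogLink s t → Prop}
  (lat : LGPGaussianLogThetaLattice LogLink IsFull)
  {Frd : Type} {IsoF : Frd → Frd → Type} {Ob : Frd → Type} {realify : Frd → Frd} {Strip : Type}
  {IsoS : Strip → Strip → Type} {Mv : ∀ v : (thetaIndex X).V, v ∈ (thetaIndex X).Vbad → Type}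
  [∀ v h, Monoid (Mv v h)]
  (sig : GlobalLGPFrobenioidSignature (thetaIndex X).lstar (thetaIndex X).V (· ∈ (thetaIndex X).Vbad)
    Frd IsoF Ob realify Strip IsoS Mv)
  (split : SplittingMonoids Mv) {ObΔ : Type} {N : ∀ v : (thetaIndex X).V, v ∈ (thetaIndex X).Vbad → Type}
  [∀ v h, Monoid (N v h)] (qData : QPilotData ObΔ N)
  (tq : ∀ (pp : Nat.Primes) (x : (thetaIndex X).Fibre (.inr pp)), haveI : Fact (pp : ℕ).Prime := ⟨pp.2⟩; kOf X pp.1 x)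
  (t : ∀ (pp : Nat.Primes) (_ : Fin X.lstar) (x : (thetaIndex X).Fibre (.inr pp)),
    haveI : Fact (pp : ℕ).Prime := ⟨pp.2⟩; kOf X pp.1 x)
  (htq0 : ∀ pp x, tq pp x ≠ 0)
  (htq1 : ∀ (pp : Nat.Primes) (x : (thetaIndex X).Fibre (.inr pp)),
    haveI : Fact (pp : ℕ).Prime := ⟨pp.2⟩; placeOf X pp.1 x ∉ X.S → ‖tq pp x‖ = 1)

/-- At an archimedean packet of `settingPrVolSharp` the cell slack is nonnegative (the q-region lies in the Θ-hull unconditionally there —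
abc-iut-w5-d107 `qRegion_subset_thetaHull_settingDHVolSharp_inl`, the trivial archimedean container — and the log-volume is monotone). [folklore] -/
theorem cellSlack_nonneg_settingPrVolSharp_inl
    (hmono : LogvolMono (settingPrVolSharp X hlog M archPk archSub Ψ act Mmod region n lat sig split qData tq t htq0 htq1))
    (hfin : (settingPrVolSharp X hlog M archPk archSub Ψ act Mmod region n lat sig split qData tq t htq0 htq1).ThetaFinite)
    (i : Fin (thetaIndex X).lstar) (u : Unit) :
    0 ≤ ((situationPrVol X hlog M archPk archSub Ψ act Mmod region).D n).logvol (Setting.labelSucc i) (.inl u)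
          ((settingPrVolSharp X hlog M archPk archSub Ψ act Mmod region n lat sig split qData tq t htq0 htq1).thetaHull
            (Setting.labelSucc i) (.inl u)) -
        (settingPrVolSharp X hlog M archPk archSub Ψ act Mmod region n lat sig split qData tq t htq0 htq1).qLocal
          (Setting.labelSucc i) (.inl u) := by
  set P := settingPrVolSharp X hlog M archPk archSub Ψ act Mmod region n lat sig split qData tq t htq0 htq1 with hP
  have hsub : P.qRegion (Setting.labelSucc i) (.inl u) ⊆ P.thetaHull (Setting.labelSucc i) (.inl u) :=
    qRegion_subset_thetaHull_settingDHVolSharp_inl X hlog M archPk archSub Ψ act Mmod region n lat sig split qData tq t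
      htq0 htq1 (Setting.labelSucc i) u
  exact sub_nonneg.mpr (hmono i (.inl u) (P.hul_adm _ _ _ (P.qRegion_mem _ _))
    (P.thetaHull_adm (Cor312Vol.hullDefined_of_thetaFinite hfin i (.inl u))) hsub)

/-- **(β) THE BOOKKEEPING — LEVEL BUDGET ⟹ STATEMENT at `settingPrVolSharp`.** Data: a finite set `W` of primes (the bad primes), a unit of
account `e_x ≥ 1` and integer LEVEL GAINS `s_i(x)` per label `i` and place `x` over `p ∈ W`, and per label a REACHED q-idele family `t_q'^{(i)}`
(nonzero, units off `S`) with `‖t_q'^{(i)}(x)‖ = ‖t_q(x)‖·p^{s_i(x)/e_x}` over `W`. Hypotheses: (α) at every packet `(i+1, p)`, `p ∈ W`,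
`t_q'^{(i)}` is MULTI-REACHED by the (Ind2)-movers (abc-iut-w5-d107's binder verbatim — abc-iut-rh-typ-10's L1
`RH.ReachLedgerVolume.levels_le_cellSlack`); off `W` the finite packets have nonnegative cell slack; and the LEVEL BUDGET
`0 ≤ Σ_{p ∈ W} log p · Σ_{x ∣ p} Pr(x) · Σ_i ⌊s_i(x)/e_x⌋`. Conclusion: the typed [IUTchIII] Cor. 3.12 `Statement`. Proof = L1 per packet +
the last-slot marginal (§2) + the generic door (§1); archimedean packets are free. [cite: DupuyHilado2025, §3.6, §3.9, §4.9]
[claim: Mochizuki2012, status: disputed] -/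
theorem statement_settingPrVolSharp_of_levelBudget
    (hmono : LogvolMono (settingPrVolSharp X hlog M archPk archSub Ψ act Mmod region n lat sig split qData tq t htq0 htq1))
    (hfin : (settingPrVolSharp X hlog M archPk archSub Ψ act Mmod region n lat sig split qData tq t htq0 htq1).ThetaFinite)
    (W : Finset Nat.Primes)
    (eIdx : ∀ pp : Nat.Primes, (thetaIndex X).Fibre (.inr pp) → ℕ) (heIdx : ∀ pp x, 1 ≤ eIdx pp x)
    (s : ∀ pp : Nat.Primes, Fin (thetaIndex X).lstar → (thetaIndex X).Fibre (.inr pp) → ℤ)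
    (tq' : ∀ (_ : Fin (thetaIndex X).lstar) (pp : Nat.Primes) (x : (thetaIndex X).Fibre (.inr pp)),
      haveI : Fact (pp : ℕ).Prime := ⟨pp.2⟩; kOf X pp.1 x)
    (htq0' : ∀ i pp x, tq' i pp x ≠ 0)
    (htq1' : ∀ (i : Fin (thetaIndex X).lstar) (pp : Nat.Primes) (x : (thetaIndex X).Fibre (.inr pp)),
      haveI : Fact (pp : ℕ).Prime := ⟨pp.2⟩; placeOf X pp.1 x ∉ X.S → ‖tq' i pp x‖ = 1)
    (hnorm : ∀ pp ∈ W, ∀ (i : Fin (thetaIndex X).lstar) (x : (thetaIndex X).Fibre (.inr pp)),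
      haveI : Fact (pp : ℕ).Prime := ⟨pp.2⟩
      ‖tq' i pp x‖ = ‖tq pp x‖ * ((pp : ℕ) : ℝ) ^ ((s pp i x : ℝ) / (eIdx pp x : ℝ)))
    (hreach : ∀ pp ∈ W, ∀ (i : Fin (thetaIndex X).lstar), haveI : Fact (pp : ℕ).Prime := ⟨pp.2⟩
      ∀ e : (thetaIndex X).Caps (Setting.labelSucc i) → (thetaIndex X).Fibre (.inr pp),
        ∃ g : (thetaIndex X).Caps (Setting.labelSucc i) → ∀ x : (thetaIndex X).Fibre (.inr pp),
            (logShellsDH X logv).carrier x.1 ≃ₗ[ℚ] (logShellsDH X logv).carrier x.1,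
          (∀ a x, g a x ∈ (logShellsDH X logv).ism x.1) ∧
          ∃ y : ∀ a, kOf X pp.1 (e a), (∀ a, ‖y a‖ ≤ 1) ∧
            ‖tq' i pp (e (Fin.last _))‖ ≤ ∏ a, ‖(presAt X hlog pp).φ (e a) (g a (e a) (((presAt X hlog pp).φ (e a)).symm
              ((if a = Fin.last _ then t pp i (e a) else 1) * y a)))‖)
    (hoff : ∀ pp ∉ W, ∀ i : Fin (thetaIndex X).lstar,
      0 ≤ ((situationPrVol X hlog M archPk archSub Ψ act Mmod region).D n).logvol (Setting.labelSucc i) (.inr pp)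
            ((settingPrVolSharp X hlog M archPk archSub Ψ act Mmod region n lat sig split qData tq t htq0 htq1).thetaHull
              (Setting.labelSucc i) (.inr pp)) -
          (settingPrVolSharp X hlog M archPk archSub Ψ act Mmod region n lat sig split qData tq t htq0 htq1).qLocal
            (Setting.labelSucc i) (.inr pp))
    (hbudget : 0 ≤ ∑ pp ∈ W, haveI : Fact (pp : ℕ).Prime := ⟨pp.2⟩
      Real.log ((pp : ℕ) : ℝ) * ∑ᶠ x : (thetaIndex X).Fibre (.inr pp), weight F (placeOf X pp.1 x) *
        ∑ i : Fin (thetaIndex X).lstar, (((s pp i x / (eIdx pp x : ℤ) : ℤ)) : ℝ)) :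
    (settingPrVolSharp X hlog M archPk archSub Ψ act Mmod region n lat sig split qData tq t htq0 htq1).Statement := by
  classical
  set P := settingPrVolSharp X hlog M archPk archSub Ψ act Mmod region n lat sig split qData tq t htq0 htq1 with hP
  -- the minorant: `log p · Σ_{v⃗} Pr(v⃗)·⌊s_i/e⌋(v_{i+1})` at the packets over `W`, `0` elsewhere
  let L : Fin (thetaIndex X).lstar → (thetaIndex X).VQ → ℝ := fun i vQ =>
    Sum.elim (fun _ => (0 : ℝ))
      (fun pp : Nat.Primes => haveI : Fact (pp : ℕ).Prime := ⟨pp.2⟩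
        Real.log ((pp : ℕ) : ℝ) * ∑ e : (presAt X hlog pp).toLocalPieces.E (Setting.labelSucc i),
          weightPr X pp.1 (Setting.labelSucc i) e *
            ((s pp i (e (Fin.last _)) / (eIdx pp (e (Fin.last _)) : ℤ) : ℤ) : ℝ))
      vQ
  -- the bad primes as rational places
  let ι : Nat.Primes ↪ (thetaIndex X).VQ := ⟨Sum.inr, Sum.inr_injective⟩
  refine statement_of_minorant_total_nonneg_on hfin (fun _ => W.map ι) L (fun i vQ hvQ => ?_)
    (fun i vQ hvQ => ?_) ?_
  · -- on `W`: L1 (levels form) at the packet `(i+1, p)`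
    obtain ⟨pp, hpp, rfl⟩ := Finset.mem_map.mp hvQ
    exact levels_le_cellSlack X hlog M archPk archSub Ψ act Mmod region n lat sig split qData tq t htq0 htq1 pp i (tq' i)
      (htq0' i) (htq1' i) (hreach pp hpp i) hmono hfin (eIdx pp) (heIdx pp) (s pp i) (hnorm pp hpp i)
  · -- off `W`: archimedean packets are free, finite ones by `hoff`
    rcases vQ with u | pp
    · exact cellSlack_nonneg_settingPrVolSharp_inl X hlog M archPk archSub Ψ act Mmod region n lat sig split qData tq t htq0
        htq1 hmono hfin i u
    · exact hoff pp (fun h => hvQ (Finset.mem_map_of_mem ι h)) i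
  · -- the total: regroup by label, then by place (last-slot marginal)
    show (0 : ℝ) ≤ ∑ i : Fin (thetaIndex X).lstar, ∑ vQ ∈ W.map ι, L i vQ
    have hprime : ∀ pp ∈ W, haveI : Fact (pp : ℕ).Prime := ⟨pp.2⟩
        Real.log ((pp : ℕ) : ℝ) * ∑ᶠ x : (thetaIndex X).Fibre (.inr pp), weight F (placeOf X pp.1 x) *
            ∑ i : Fin (thetaIndex X).lstar, (((s pp i x / (eIdx pp x : ℤ) : ℤ)) : ℝ) =
          ∑ i : Fin (thetaIndex X).lstar, L i (ι pp) := by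
      intro pp _
      haveI : Fact (pp : ℕ).Prime := ⟨pp.2⟩
      haveI : Fintype ((thetaIndex X).Fibre (.inr pp)) := Fintype.ofFinite _
      have hmarg : ∀ i : Fin (thetaIndex X).lstar, L i (ι pp) =
          Real.log ((pp : ℕ) : ℝ) * ∑ x : (thetaIndex X).Fibre (.inr pp), weight F (placeOf X pp.1 x) *
            (((s pp i x / (eIdx pp x : ℤ) : ℤ)) : ℝ) := by
        intro i
        show Real.log ((pp : ℕ) : ℝ) * ∑ e : (presAt X hlog pp).toLocalPieces.E (Setting.labelSucc i),
            weightPr X pp.1 (Setting.labelSucc i) e *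
              (((s pp i (e (Fin.last _)) / (eIdx pp (e (Fin.last _)) : ℤ) : ℤ)) : ℝ) = _
        rw [sum_weightPr_mul_last_eq_finsum X hlog pp (Setting.labelSucc i)
          (fun x => (((s pp i x / (eIdx pp x : ℤ) : ℤ)) : ℝ)), finsum_eq_sum_of_fintype]
      calc Real.log ((pp : ℕ) : ℝ) * ∑ᶠ x : (thetaIndex X).Fibre (.inr pp), weight F (placeOf X pp.1 x) *
              ∑ i : Fin (thetaIndex X).lstar, (((s pp i x / (eIdx pp x : ℤ) : ℤ)) : ℝ)
          = Real.log ((pp : ℕ) : ℝ) * ∑ x : (thetaIndex X).Fibre (.inr pp), ∑ i : Fin (thetaIndex X).lstar,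
              weight F (placeOf X pp.1 x) * (((s pp i x / (eIdx pp x : ℤ) : ℤ)) : ℝ) := by
            rw [finsum_eq_sum_of_fintype]
            exact congrArg _ (Finset.sum_congr rfl fun x _ => Finset.mul_sum _ _ _)
        _ = Real.log ((pp : ℕ) : ℝ) * ∑ i : Fin (thetaIndex X).lstar, ∑ x : (thetaIndex X).Fibre (.inr pp),
              weight F (placeOf X pp.1 x) * (((s pp i x / (eIdx pp x : ℤ) : ℤ)) : ℝ) := by rw [Finset.sum_comm]
        _ = ∑ i : Fin (thetaIndex X).lstar, L i (ι pp) := by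
            rw [Finset.mul_sum]
            exact Finset.sum_congr rfl fun i _ => (hmarg i).symm
    calc (0 : ℝ) ≤ _ := hbudget
      _ = ∑ pp ∈ W, ∑ i : Fin (thetaIndex X).lstar, L i (ι pp) := Finset.sum_congr rfl hprime
      _ = ∑ i : Fin (thetaIndex X).lstar, ∑ pp ∈ W, L i (ι pp) := Finset.sum_comm
      _ = ∑ i : Fin (thetaIndex X).lstar, ∑ vQ ∈ W.map ι, L i vQ :=
          Finset.sum_congr rfl fun i _ => (Finset.sum_map W ι (L i)).symm

/-- **PER-PLACE LEDGER form** (row 27's shape: no cross-place financing). Same as `statement_settingPrVolSharp_of_levelBudget` with the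
budget replaced by «at every place `x` over a prime of `W`, `0 ≤ Σ_i ⌊s_i(x)/e_x⌋`» (then every summand `log p · Pr(x) · (…)` of the budget
is nonnegative). [claim: Mochizuki2012, status: disputed] -/
theorem statement_settingPrVolSharp_of_placeLedger
    (hmono : LogvolMono (settingPrVolSharp X hlog M archPk archSub Ψ act Mmod region n lat sig split qData tq t htq0 htq1))
    (hfin : (settingPrVolSharp X hlog M archPk archSub Ψ act Mmod region n lat sig split qData tq t htq0 htq1).ThetaFinite)
    (W : Finset Nat.Primes)
    (eIdx : ∀ pp : Nat.Primes, (thetaIndex X).Fibre (.inr pp) → ℕ) (heIdx : ∀ pp x, 1 ≤ eIdx pp x)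
    (s : ∀ pp : Nat.Primes, Fin (thetaIndex X).lstar → (thetaIndex X).Fibre (.inr pp) → ℤ)
    (tq' : ∀ (_ : Fin (thetaIndex X).lstar) (pp : Nat.Primes) (x : (thetaIndex X).Fibre (.inr pp)),
      haveI : Fact (pp : ℕ).Prime := ⟨pp.2⟩; kOf X pp.1 x)
    (htq0' : ∀ i pp x, tq' i pp x ≠ 0)
    (htq1' : ∀ (i : Fin (thetaIndex X).lstar) (pp : Nat.Primes) (x : (thetaIndex X).Fibre (.inr pp)),
      haveI : Fact (pp : ℕ).Prime := ⟨pp.2⟩; placeOf X pp.1 x ∉ X.S → ‖tq' i pp x‖ = 1)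
    (hnorm : ∀ pp ∈ W, ∀ (i : Fin (thetaIndex X).lstar) (x : (thetaIndex X).Fibre (.inr pp)),
      haveI : Fact (pp : ℕ).Prime := ⟨pp.2⟩
      ‖tq' i pp x‖ = ‖tq pp x‖ * ((pp : ℕ) : ℝ) ^ ((s pp i x : ℝ) / (eIdx pp x : ℝ)))
    (hreach : ∀ pp ∈ W, ∀ (i : Fin (thetaIndex X).lstar), haveI : Fact (pp : ℕ).Prime := ⟨pp.2⟩
      ∀ e : (thetaIndex X).Caps (Setting.labelSucc i) → (thetaIndex X).Fibre (.inr pp),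
        ∃ g : (thetaIndex X).Caps (Setting.labelSucc i) → ∀ x : (thetaIndex X).Fibre (.inr pp),
            (logShellsDH X logv).carrier x.1 ≃ₗ[ℚ] (logShellsDH X logv).carrier x.1,
          (∀ a x, g a x ∈ (logShellsDH X logv).ism x.1) ∧
          ∃ y : ∀ a, kOf X pp.1 (e a), (∀ a, ‖y a‖ ≤ 1) ∧
            ‖tq' i pp (e (Fin.last _))‖ ≤ ∏ a, ‖(presAt X hlog pp).φ (e a) (g a (e a) (((presAt X hlog pp).φ (e a)).symm
              ((if a = Fin.last _ then t pp i (e a) else 1) * y a)))‖)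
    (hoff : ∀ pp ∉ W, ∀ i : Fin (thetaIndex X).lstar,
      0 ≤ ((situationPrVol X hlog M archPk archSub Ψ act Mmod region).D n).logvol (Setting.labelSucc i) (.inr pp)
            ((settingPrVolSharp X hlog M archPk archSub Ψ act Mmod region n lat sig split qData tq t htq0 htq1).thetaHull
              (Setting.labelSucc i) (.inr pp)) -
          (settingPrVolSharp X hlog M archPk archSub Ψ act Mmod region n lat sig split qData tq t htq0 htq1).qLocal
            (Setting.labelSucc i) (.inr pp))
    (hledger : ∀ pp ∈ W, ∀ x : (thetaIndex X).Fibre (.inr pp),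
      0 ≤ ∑ i : Fin (thetaIndex X).lstar, (s pp i x / (eIdx pp x : ℤ) : ℤ)) :
    (settingPrVolSharp X hlog M archPk archSub Ψ act Mmod region n lat sig split qData tq t htq0 htq1).Statement := by
  refine statement_settingPrVolSharp_of_levelBudget X hlog M archPk archSub Ψ act Mmod region n lat sig split qData tq t htq0
    htq1 hmono hfin W eIdx heIdx s tq' htq0' htq1' hnorm hreach hoff (Finset.sum_nonneg fun pp hpp => ?_)
  haveI : Fact (pp : ℕ).Prime := ⟨pp.2⟩
  refine mul_nonneg (Real.log_nonneg (by exact_mod_cast pp.2.one_lt.le)) (finsum_nonneg fun x => ?_)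
  refine mul_nonneg (weight_nonneg F _) ?_
  have h := hledger pp hpp x
  exact_mod_cast h

/-- **The packets over a prime with NO bad place are free** (identity movers): if every place over `p` lies outside `S` and the Θ-ideles are
units there (`ht1`), the cell slack at `(i+1, p)` is nonnegative — abc-iut-rp-d3's good-last-place branch of
`RHSlotReachGlue.multiReach_of_slotReachWindow`, fed to L1 with zero gain. [cite: DupuyHilado2025, §3.9, §4.9] [claim: Mochizuki2012, status: disputed] -/
theorem cellSlack_nonneg_settingPrVolSharp_of_good
    (hmono : LogvolMono (settingPrVolSharp X hlog M archPk archSub Ψ act Mmod region n lat sig split qData tq t htq0 htq1))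
    (hfin : (settingPrVolSharp X hlog M archPk archSub Ψ act Mmod region n lat sig split qData tq t htq0 htq1).ThetaFinite)
    (ht1 : ∀ (pp : Nat.Primes) (i : Fin X.lstar) (x : (thetaIndex X).Fibre (.inr pp)),
      haveI : Fact (pp : ℕ).Prime := ⟨pp.2⟩; placeOf X pp.1 x ∉ X.S → ‖t pp i x‖ = 1)
    (pp : Nat.Primes) (hgood : ∀ x : (thetaIndex X).Fibre (.inr pp), haveI : Fact (pp : ℕ).Prime := ⟨pp.2⟩; placeOf X pp.1 x ∉ X.S)
    (i : Fin (thetaIndex X).lstar) :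
    0 ≤ ((situationPrVol X hlog M archPk archSub Ψ act Mmod region).D n).logvol (Setting.labelSucc i) (.inr pp)
          ((settingPrVolSharp X hlog M archPk archSub Ψ act Mmod region n lat sig split qData tq t htq0 htq1).thetaHull
            (Setting.labelSucc i) (.inr pp)) -
        (settingPrVolSharp X hlog M archPk archSub Ψ act Mmod region n lat sig split qData tq t htq0 htq1).qLocal
          (Setting.labelSucc i) (.inr pp) := by
  haveI : Fact (pp : ℕ).Prime := ⟨pp.2⟩
  classical
  have h := reachGain_le_cellSlack X hlog M archPk archSub Ψ act Mmod region n lat sig split qData tq t htq0 htq1 pp i tq htq0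
    htq1 (fun e => ?_) hmono hfin
  · simpa only [sub_self, mul_zero, Finset.sum_const_zero] using h
  · -- identity movers, box point `y = 1`
    refine ⟨fun _ _ => LinearEquiv.refl ℚ _, fun _ x => (logShellsDH X logv).one_mem_ism x.1, fun _ => 1,
      fun _ => norm_one.le, ?_⟩
    have hprod : ∏ a, ‖(presAt X hlog pp).φ (e a) ((LinearEquiv.refl ℚ _)
        (((presAt X hlog pp).φ (e a)).symm ((if a = Fin.last _ then t pp i (e a) else 1) * (1 : kOf X pp.1 (e a)))))‖ = 1 := by
      refine Finset.prod_eq_one fun a _ => ?_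
      rw [mul_one, LinearEquiv.refl_apply, LinearEquiv.apply_symm_apply]
      split_ifs with ha
      · exact ht1 pp i _ (hgood _)
      · exact (norm_one (α := kOf X pp.1 (e a)))
    rw [hprod, htq1 pp _ (hgood _)]

end Sharp



end Summit.ABC.IUTFork.Repair.RH.ReachLedgerBookkeeping

end
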